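import Mathlib.RepresentationTheory.Irreducible
import Literature.NumberTheory.GaloisRepresentations.WeilDeligneFrobSemisimpleIff
import Literature.NumberTheory.GaloisRepresentations.WeilDeligneSemisimpleTraces
import Summits.Langlands.Langlands.Theorems.IrreducibilityBySelfDualityReciprocityUpToIrreducibilityRStringDefs
import HarnessLib

/-!
# Stub F3c of line `PhantomRMJunctionOfPieces` (crux stmt-Langlands-13643): the standard string `ρ ⊗ Sp(a)`
# over an irreducible head is Frobenius-semisimple and indecomposable

For an irreducible continuous representation `ρ` of `W_F` on a finite-dimensional complex space `H` and
`a ≥ 1`, the standard string `stringModel ρ hρ a` of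
`Theorems/IrreducibilityBySelfDualityReciprocityUpToIrreducibilityRStringDefs` (carrier `Fin a → H`, slot
`j` carrying the unramified twist `ρ ⊗ ‖·‖^j`, monodromy = the shift `y_j ↦ y_{j-1}`) is

* **Frobenius-semisimple**: `ρ` irreducible ⇒ semisimple ⇒ every `ρ(w)` is a semisimple endomorphism
  (tree: `WeilDeligneRep.isFrobSemisimple_of_isSemisimpleRepresentation`, Deligne 1973 §8.6 / §4.10); the
  slots `single j (H)` are `ρ ⊗ Sp(a)`-invariant, cover `Fin a → H`, and on slot `j` the action is conjugate
  to the non-zero scalar multiple `q^{j deg w} ρ(w)`, so it is semisimple there, hence everywhere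
  (tree: `LinearMap.isSemisimple_of_forall_restrict_of_iSup_eq_top`);
* **indecomposable** (socle argument, Tate, Corvallis 1979, (4.1.5)): every non-zero sub-Weil–Deligne
  representation `p` contains the last slot — push a non-zero `x ∈ p` with lowest non-zero slot `j₀` by
  `N^{a-1-j₀}` into the last slot, pull `p` back to `H` along `h ↦ single (a-1) h` to get a non-zero
  `ρ`-subrepresentation, which is everything by irreducibility; two complementary non-zero
  sub-representations would then both contain the (non-zero) last slot.

No definitions; standard axioms; no `sorry`.

References: J. Tate, *Number theoretic background*, Corvallis 1979, (4.1.4)–(4.1.5) [TateCorvallis1979];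
P. Deligne, *Les constantes des équations fonctionnelles des fonctions L*, Antwerp II, LNM 349 (1973), §8.6
[Deligne1973Constantes].
-/

noncomputable section

set_option linter.dupNamespace false

open Module
open Literature.NumberTheory.Automorphic Literature.NumberTheory.GaloisRepresentations
open Literature.NumberTheory.GaloisRepresentations.WeilGroup
open Literature.NumberTheory.GaloisRepresentations.IsNonarchimedeanLocalField
open Summit.Langlands.Langlands.Theorems.ReciprocityUpToIrreducibilityR

namespace Summit.Langlands.Langlands.Theorems.PhantomRMJunctionOfPieces

variable {F : Type} [Field F] [ValuativeRel F] [TopologicalSpace F] [IsNonarchimedeanLocalField F]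
variable {H : Type} [AddCommGroup H] [Module ℂ H]

/-! ## The slots of the standard string -/

/-- `ρ ⊗ Sp(d)` acts on the `j`-th slot vector `single j h` by `single j (q^{j deg w} ρ(w) h)`.
[cite: TateCorvallis1979, (4.1.4)] -/
theorem stringModelRep_single (ρ : Representation ℂ (WeilGroup F) H) (d : ℕ) (w : WeilGroup F)
    (j : Fin d) (h : H) :
    stringModelRep ρ d w (Pi.single j h) =
      Pi.single j ((((residueFieldCard F : ℂ) ^ (deg w)) ^ (j : ℕ)) • ρ w h) := by
  funext i
  rw [stringModelRep_apply]
  by_cases hij : i = j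
  · subst hij
    rw [Pi.single_eq_same, Pi.single_eq_same]
  · rw [Pi.single_eq_of_ne hij, Pi.single_eq_of_ne hij, map_zero, smul_zero]

/-- The `j`-th slot `single j (H)` is invariant under `ρ ⊗ Sp(d)(w)` (the action is slot-wise).
[cite: TateCorvallis1979, (4.1.4)] -/
theorem range_single_mem_invtSubmodule (ρ : Representation ℂ (WeilGroup F) H) (d : ℕ)
    (w : WeilGroup F) (j : Fin d) :
    LinearMap.range (LinearMap.single ℂ (fun _ : Fin d => H) j) ∈
      Module.End.invtSubmodule (stringModelRep ρ d w) := by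
  rw [Module.End.mem_invtSubmodule]
  rintro _ ⟨h, rfl⟩
  rw [Submodule.mem_comap, LinearMap.coe_single, stringModelRep_single]
  exact ⟨_, rfl⟩

/-- On the `j`-th slot, `ρ ⊗ Sp(d)(w)` is conjugate (along `h ↦ single j h`) to the non-zero scalar
multiple `q^{j deg w} ρ(w)` of `ρ(w)`; so it is semisimple there as soon as `ρ(w)` is.
[cite: Deligne1973Constantes, §8.6] -/
theorem isSemisimple_restrict_range_single (ρ : Representation ℂ (WeilGroup F) H) (d : ℕ)
    (w : WeilGroup F) (j : Fin d) (hw : Module.End.IsSemisimple (ρ w)) :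
    Module.End.IsSemisimple
      ((stringModelRep ρ d w).restrict (range_single_mem_invtSubmodule ρ d w j)) := by
  set c : ℂ := ((residueFieldCard F : ℂ) ^ (deg w)) ^ (j : ℕ)
  let e : H ≃ₗ[ℂ] LinearMap.range (LinearMap.single ℂ (fun _ : Fin d => H) j) :=
    LinearEquiv.ofInjective _ (Pi.single_injective (M := fun _ : Fin d => H) j)
  refine (e.isSemisimple_iff (c • ρ w) _ ?_).mp (Module.End.IsSemisimple_smul c hw)
  refine LinearMap.ext fun h => Subtype.ext ?_
  simp only [LinearMap.coe_comp, LinearEquiv.coe_coe, Function.comp_apply,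
    LinearEquiv.ofInjective_apply, LinearMap.coe_restrict_apply, LinearMap.coe_single,
    LinearMap.smul_apply, stringModelRep_single, e, c]

/-- **`ρ ⊗ Sp(d)` is Frobenius-semisimple for `ρ` irreducible** (finite-dimensional, continuous): an
irreducible representation is semisimple, so every `ρ(w)` is a semisimple endomorphism (Deligne 1973 §8.6,
tree `isFrobSemisimple_of_isSemisimpleRepresentation`), hence so is `ρ ⊗ Sp(d)(w)`, which is semisimple on
each slot of the covering family of invariant slots. [cite: Deligne1973Constantes, §8.6] -/
theorem isFrobSemisimple_stringModel [FiniteDimensional ℂ H] (ρ : Representation ℂ (WeilGroup F) H)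
    (hρ : IsContinuousRep ρ) (hirr : ρ.IsIrreducible) (d : ℕ) :
    (stringModel ρ hρ d).IsFrobSemisimple := by
  have hsr : ρ.IsSemisimpleRepresentation := by
    haveI := hirr
    infer_instance
  have hss : (WeilDeligneRep.ofRep ρ hρ).IsFrobSemisimple :=
    (WeilDeligneRep.ofRep ρ hρ).isFrobSemisimple_of_isSemisimpleRepresentation hsr
  intro w
  rw [stringModel_ρ]
  exact LinearMap.isSemisimple_of_forall_restrict_of_iSup_eq_top
    (fun j : Fin d => LinearMap.range (LinearMap.single ℂ (fun _ : Fin d => H) j))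
    (fun j => range_single_mem_invtSubmodule ρ d w j)
    (fun j => isSemisimple_restrict_range_single ρ d w j (hss w))
    (LinearMap.iSup_range_single ℂ _)

/-! ## The socle of the standard string -/

/-- In `ρ ⊗ Sp(d+1)`, every non-zero `N`-stable subspace contains a non-zero vector of the last slot: push a
non-zero `x` with lowest non-zero slot `j₀` by `N^{d-j₀}`. [cite: TateCorvallis1979, (4.1.5)] -/
theorem exists_single_last_mem (ρ : Representation ℂ (WeilGroup F) H) (hρ : IsContinuousRep ρ) (d : ℕ)
    {p : Submodule ℂ (Fin (d + 1) → H)} (hN : p ≤ p.comap (stringModel ρ hρ (d + 1)).N)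
    (hbot : p ≠ ⊥) : ∃ h : H, h ≠ 0 ∧ Pi.single (Fin.last d) h ∈ p := by
  obtain ⟨x, hxp, hx0⟩ := (Submodule.ne_bot_iff p).mp hbot
  obtain ⟨j, hj⟩ := Function.ne_iff.mp hx0
  obtain ⟨j₀, hj₀, hmin⟩ :=
    (wellFounded_lt (α := Fin (d + 1))).has_min {j | x j ≠ 0} ⟨j, hj⟩
  have hpow : ∀ k : ℕ, ∀ y ∈ p, (shiftMap H (d + 1) ^ k) y ∈ p := by
    intro k
    induction k with
    | zero => intro y hy; simpa using hy
    | succ k ih =>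
      intro y hy
      rw [pow_succ', Module.End.mul_apply]
      exact hN (ih y hy)
  refine ⟨x j₀, hj₀, ?_⟩
  have hj₀d : (j₀ : ℕ) ≤ d := Nat.le_of_lt_succ j₀.isLt
  have key : (shiftMap H (d + 1) ^ (d - (j₀ : ℕ))) x = Pi.single (Fin.last d) (x j₀) := by
    funext i
    rw [shiftMap_pow_apply]
    by_cases hi : i = Fin.last d
    · subst hi
      rw [Pi.single_eq_same, dif_pos (by rw [Fin.val_last]; exact Nat.sub_le d _)]
      congr 1
      exact Fin.ext (by dsimp only; rw [Fin.val_last]; omega)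
    · rw [Pi.single_eq_of_ne hi]
      have hid : (i : ℕ) < d := Fin.val_lt_last hi
      split_ifs with hle
      · by_contra hne
        exact hmin _ hne (Fin.lt_def.mpr (by dsimp only; omega))
      · rfl
  rw [← key]
  exact hpow _ x hxp

/-- **The last slot is the socle of `ρ ⊗ Sp(d+1)` over an irreducible `ρ`**: every non-zero
sub-Weil–Deligne representation `p` contains `single d h` for every `h ∈ H` — the pull-back of `p` along
`h ↦ single d h` is `ρ`-stable (on the last slot `ρ ⊗ Sp(d+1)(w)` is `q^{d deg w} ρ(w)`, a unit multiple)
and non-zero, hence everything. [cite: TateCorvallis1979, (4.1.5)] -/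
theorem single_last_mem_of_isSubrep (ρ : Representation ℂ (WeilGroup F) H) (hρ : IsContinuousRep ρ)
    (hirr : ρ.IsIrreducible) (d : ℕ) {p : Submodule ℂ (Fin (d + 1) → H)}
    (hp : (stringModel ρ hρ (d + 1)).IsSubrep p) (hbot : p ≠ ⊥) (h : H) :
    Pi.single (Fin.last d) h ∈ p := by
  obtain ⟨h₀, hh₀, hmem⟩ := exists_single_last_mem ρ hρ d hp.2 hbot
  obtain ⟨Q, hQ⟩ : ∃ Q : Subrepresentation ρ,
      Q.toSubmodule = p.comap (LinearMap.single ℂ (fun _ : Fin (d + 1) => H) (Fin.last d)) := by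
    refine ⟨⟨p.comap (LinearMap.single ℂ (fun _ : Fin (d + 1) => H) (Fin.last d)),
      fun w v hv => ?_⟩, rfl⟩
    rw [Submodule.mem_comap, LinearMap.coe_single] at hv ⊢
    have h1 : stringModelRep ρ (d + 1) w (Pi.single (Fin.last d) v) ∈ p := hp.1 w hv
    rw [stringModelRep_single, Pi.single_smul] at h1
    exact (p.smul_mem_iff (qpow_ne_zero w _)).mp h1
  haveI := hirr
  have hQbot : Q ≠ ⊥ := by
    intro hQ'
    have hmem' : h₀ ∈ Q.toSubmodule := by
      rw [hQ, Submodule.mem_comap, LinearMap.coe_single]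
      exact hmem
    rw [hQ'] at hmem'
    exact hh₀ ((Submodule.mem_bot ℂ).mp hmem')
  have htop : Q = ⊤ := (eq_bot_or_eq_top Q).resolve_left hQbot
  have hh : h ∈ Q.toSubmodule := by
    rw [htop]
    exact Submodule.mem_top
  rw [hQ, Submodule.mem_comap, LinearMap.coe_single] at hh
  exact hh

/-- An irreducible representation lives on a non-zero space (`⊥ ≠ ⊤` among its subrepresentations).
[folklore] -/
theorem nontrivial_of_isIrreducible (ρ : Representation ℂ (WeilGroup F) H) (hirr : ρ.IsIrreducible) :
    Nontrivial H := by
  by_contra hH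
  haveI : Subsingleton H := not_nontrivial_iff_subsingleton.mp hH
  haveI : Subsingleton (Subrepresentation ρ) :=
    ⟨fun p q => Subrepresentation.toSubmodule_injective (Subsingleton.elim _ _)⟩
  haveI := hirr.toNontrivial
  exact false_of_nontrivial_of_subsingleton (Subrepresentation ρ)

/-- **`ρ ⊗ Sp(d+1)` is indecomposable for `ρ` irreducible**: two complementary non-zero sub-Weil–Deligne
representations would both contain the non-zero last slot (the socle). [cite: TateCorvallis1979, (4.1.5)] -/
theorem isIndecomposable_stringModel (ρ : Representation ℂ (WeilGroup F) H) (hρ : IsContinuousRep ρ)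
    (hirr : ρ.IsIrreducible) (d : ℕ) : (stringModel ρ hρ (d + 1)).IsIndecomposable := by
  haveI : Nontrivial H := nontrivial_of_isIrreducible ρ hirr
  refine ⟨inferInstance, fun p p' hp hp' hc => ?_⟩
  by_contra hne
  obtain ⟨hpne, hp'ne⟩ := not_or.mp hne
  obtain ⟨h, hh⟩ := exists_ne (0 : H)
  have hmem : Pi.single (Fin.last d) h ∈ p ⊓ p' :=
    ⟨single_last_mem_of_isSubrep ρ hρ hirr d hp hpne h,
      single_last_mem_of_isSubrep ρ hρ hirr d hp' hp'ne h⟩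
  rw [hc.inf_eq_bot, Submodule.mem_bot, Pi.single_eq_zero_iff] at hmem
  exact hh hmem

/-- **Stub F3c — the standard string over an irreducible head is an admissible probe.**  For an irreducible
continuous `ρ` of `W_F` on a finite-dimensional `H` and `a ≥ 1`, the standard string `ρ ⊗ Sp(a)`
(`stringModel ρ hρ a`: slot `j` carries `ρ ⊗ ‖·‖^j`, `N` = shift) is Frobenius-semisimple (an irreducible
continuous representation of `W_F` is Frobenius-semisimple, and so are its unramified twists slot by slot) and
indecomposable (every non-zero sub-Weil–Deligne representation contains the socle slot `a - 1`).
[cite: TateCorvallis1979, (4.1.4)–(4.1.5)] [cite: Deligne1973Constantes, §8.6] -/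
theorem stub_stringModel_admissible : ∀ (F : Type) [Field F] [ValuativeRel F] [TopologicalSpace F] [IsNonarchimedeanLocalField F] (H : Type) [AddCommGroup H] [Module ℂ H] [FiniteDimensional ℂ H] (ρ : Representation ℂ (WeilGroup F) H) (hρ : WeilGroup.IsContinuousRep ρ), ρ.IsIrreducible → ∀ a : ℕ, 0 < a → (Summit.Langlands.Langlands.Theorems.ReciprocityUpToIrreducibilityR.stringModel ρ hρ a).IsFrobSemisimple ∧ (Summit.Langlands.Langlands.Theorems.ReciprocityUpToIrreducibilityR.stringModel ρ hρ a).IsIndecomposable := by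
  intro F _ _ _ _ H _ _ _ ρ hρ hirr a ha
  obtain ⟨d, rfl⟩ : ∃ d, a = d + 1 := ⟨a - 1, by omega⟩
  exact ⟨isFrobSemisimple_stringModel ρ hρ hirr (d + 1), isIndecomposable_stringModel ρ hρ hirr d⟩

end Summit.Langlands.Langlands.Theorems.PhantomRMJunctionOfPieces

end
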